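import Mathlib
import Summits.MatrixMultiplication.MatrixMultiplication.Theses.LevelGradedCohnUmans
import Literature.Computability.AlgebraicComplexity.BCGPUInfiniteGroupsProofs
import Literature.RepresentationTheory.FiniteGroups.WedderburnBlocks
import Literature.Computability.AlgebraicComplexity.GroupAlgebraTensor

/-!
# Crux-ideate sketch for `GradedPricing` (stmt-MatrixMultiplication-7611), idea `matrix-unit-sandwich`

Validation of the lever (ideator 1, round 1). Everything here is PROVED (no `sorry`; axioms
`propext`, `Classical.choice`, `Quot.sound`): Fourier inversion in Wedderburn coordinates, the
kernel dichotomy ("matrix-unit sandwich"), `J ⊆ RepFun(Λ_J)`, the block/character bookkeeping, the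
repackaging of `J`-separation into the hypotheses of the tree's PROVED
`BCGPU2024_thm_2_2_corrected_holds`, and the composition
`gradedPricing_candidate : …LevelGradedCohnUmans.GradedPricing` (audit class `proof-of-item`).
This is a CANDIDATE for a prover to land under `Theorems/` (planner seats do not propose proofs).
-/

noncomputable section

namespace Summit.MatrixMultiplication.MatrixMultiplication.Cruxes.GradedPricing.MatrixUnitSandwich

open scoped BigOperators Classical Pointwise
open Literature.RepresentationTheory.FiniteGroups Literature.Computability.AlgebraicComplexity

variable {G : Type} [Group G] [Fintype G]
variable {r : ℕ} {d : Fin r → ℕ}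

/-! ## The functional `f̃` and Fourier coefficients in Wedderburn coordinates -/

/-- The linear functional `u ↦ Σ_g u(g) f(g)` on `ℂ[G]` attached to `f : G → ℂ` (`f̃`). -/
def pairing (f : G → ℂ) (u : MonoidAlgebra ℂ G) : ℂ := ∑ g, u.coeff g * f g

theorem pairing_single (f : G → ℂ) (g : G) : pairing f (MonoidAlgebra.single g 1) = f g := by
  unfold pairing
  rw [Finset.sum_eq_single g]
  · simp [MonoidAlgebra.coeff_single]
  · intro h _ hne
    simp [MonoidAlgebra.coeff_single, Finsupp.single_apply, Ne.symm hne]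
  · intro h
    exact absurd (Finset.mem_univ g) h

theorem pairing_add (f : G → ℂ) (u v : MonoidAlgebra ℂ G) :
    pairing f (u + v) = pairing f u + pairing f v := by
  simp only [pairing, MonoidAlgebra.coeff_add, Finsupp.add_apply, add_mul, Finset.sum_add_distrib]

theorem pairing_smul (f : G → ℂ) (c : ℂ) (u : MonoidAlgebra ℂ G) :
    pairing f (c • u) = c * pairing f u := by
  simp only [pairing, MonoidAlgebra.coeff_smul, Finsupp.smul_apply, smul_eq_mul, Finset.mul_sum,
    mul_assoc]

theorem pairing_zero (f : G → ℂ) : pairing f 0 = 0 := by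
  simp [pairing]

theorem pairing_sum {ι : Type*} (s : Finset ι) (f : G → ℂ) (u : ι → MonoidAlgebra ℂ G) :
    pairing f (∑ i ∈ s, u i) = ∑ i ∈ s, pairing f (u i) := by
  induction s using Finset.induction_on with
  | empty => simp [pairing_zero]
  | insert a s ha ih => rw [Finset.sum_insert ha, Finset.sum_insert ha, pairing_add, ih]

/-- Fourier coefficient of `f` at the matrix unit `k = (i,a,b)` of `∏ᵢ ℂ^{dᵢ×dᵢ}`: `f̃(φ⁻¹ E_k)`. -/
def fourierCoeff (φ : MonoidAlgebra ℂ G ≃ₐ[ℂ] BlockAlgebraC d) (f : G → ℂ) (k : BlockIndex d) : ℂ :=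
  pairing f (φ.symm (blockBasis ℂ d k))

/-- The `i`-th Wedderburn block as a matrix-valued monoid hom `g ↦ (φ g)ᵢ` (same data as the
tree's `blockRep φ i`, but landing in matrices so that `.toHomUnits` is a `G →* GL`). -/
def blockHom (φ : MonoidAlgebra ℂ G ≃ₐ[ℂ] BlockAlgebraC d) (i : Fin r) :
    G →* Matrix (Fin (d i)) (Fin (d i)) ℂ :=
  ((Pi.evalAlgHom ℂ (fun i : Fin r => Matrix (Fin (d i)) (Fin (d i)) ℂ) i).comp
    φ.toAlgHom).toMonoidHom.comp (MonoidAlgebra.of ℂ G)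

omit [Fintype G] in
theorem blockHom_apply (φ : MonoidAlgebra ℂ G ≃ₐ[ℂ] BlockAlgebraC d) (i : Fin r) (g : G) :
    blockHom φ i g = φ (MonoidAlgebra.single g 1) i := rfl

omit [Fintype G] in
/-- The tree's block basis vectors are the matrix units `Pi.single i (E_{ab})`. -/
theorem blockBasis_eq_single (i : Fin r) (a b : Fin (d i)) :
    blockBasis ℂ d ⟨i, (a, b)⟩ = Pi.single i (Matrix.single a b (1 : ℂ)) := by
  funext j
  ext u v
  rw [blockBasis_apply]
  by_cases h : j = i
  · subst h
    rw [Pi.single_eq_same]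
    simp only [Matrix.single, Matrix.of_apply, Sigma.mk.inj_iff, heq_eq_eq, Prod.mk.injEq, true_and]
    by_cases h1 : u = a
    · by_cases h2 : v = b
      · subst h1; subst h2; simp
      · simp [h2, Ne.symm h2]
    · simp [h1, Ne.symm h1]
  · rw [Pi.single_eq_of_ne h, Matrix.zero_apply, if_neg]
    intro e
    exact h (congrArg Sigma.fst e)

omit [Fintype G] in
theorem blockBasis_repr_apply (P : BlockAlgebraC d) (k : BlockIndex d) :
    (blockBasis ℂ d).repr P k = P k.1 k.2.1 k.2.2 := by
  rw [blockBasis, Module.Basis.ofEquivFun_repr_apply]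
  rfl

/-- **Fourier inversion in Wedderburn coordinates**: `f(g) = Σ_k f̃(φ⁻¹E_k) · (φ g)_k`
(apply `f̃` to `g = φ⁻¹(Σ_k (φ g)_k E_k)`). -/
theorem eq_sum_fourierCoeff_mul (φ : MonoidAlgebra ℂ G ≃ₐ[ℂ] BlockAlgebraC d) (f : G → ℂ) (g : G) :
    f g = ∑ k : BlockIndex d, fourierCoeff φ f k * φ (MonoidAlgebra.single g 1) k.1 k.2.1 k.2.2 := by
  have h1 : MonoidAlgebra.single g (1 : ℂ) =
      ∑ k : BlockIndex d, (φ (MonoidAlgebra.single g 1) k.1 k.2.1 k.2.2) •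
        φ.symm (blockBasis ℂ d k) := by
    calc MonoidAlgebra.single g (1 : ℂ) = φ.symm (φ (MonoidAlgebra.single g 1)) :=
          (φ.symm_apply_apply _).symm
      _ = φ.symm (∑ k, (blockBasis ℂ d).repr (φ (MonoidAlgebra.single g 1)) k • blockBasis ℂ d k) := by
          rw [(blockBasis ℂ d).sum_repr]
      _ = _ := by
          rw [map_sum]
          refine Finset.sum_congr rfl fun k _ => ?_
          rw [map_smul, blockBasis_repr_apply]
  calc f g = pairing f (MonoidAlgebra.single g 1) := (pairing_single f g).symm
    _ = ∑ k : BlockIndex d, (φ (MonoidAlgebra.single g 1) k.1 k.2.1 k.2.2) *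
          pairing f (φ.symm (blockBasis ℂ d k)) := by
        conv_lhs => rw [h1]
        rw [pairing_sum]
        exact Finset.sum_congr rfl fun k _ => pairing_smul _ _ _
    _ = _ := Finset.sum_congr rfl fun k _ => by rw [mul_comm]; rfl

/-! ## Bi-invariance ⇒ closure under generalized bi-translates `g ↦ f̃(x · g · y)` -/

theorem pairing_mul_single_mul_mem (J : Submodule ℂ (G → ℂ))
    (hJ : ∀ f ∈ J, ∀ a b : G, (fun g : G => f (a * g * b)) ∈ J)
    {f : G → ℂ} (hf : f ∈ J) (x y : MonoidAlgebra ℂ G) :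
    (fun g => pairing f (x * MonoidAlgebra.single g 1 * y)) ∈ J := by
  induction x using MonoidAlgebra.induction_linear with
  | zero =>
    have : (fun g : G => pairing f (0 * MonoidAlgebra.single g 1 * y)) = 0 := by
      funext g; simp [pairing_zero]
    rw [this]; exact J.zero_mem
  | add x x' hx hx' =>
    have : (fun g => pairing f ((x + x') * MonoidAlgebra.single g 1 * y)) =
        (fun g => pairing f (x * MonoidAlgebra.single g 1 * y)) +
          fun g => pairing f (x' * MonoidAlgebra.single g 1 * y) := by
      funext g; simp only [add_mul, Pi.add_apply, pairing_add]
    rw [this]; exact J.add_mem hx hx'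
  | single a c =>
    induction y using MonoidAlgebra.induction_linear with
    | zero =>
      have : (fun g : G => pairing f (MonoidAlgebra.single a c * MonoidAlgebra.single g 1 * 0)) = 0 := by
        funext g; simp [pairing_zero]
      rw [this]; exact J.zero_mem
    | add y y' hy hy' =>
      have : (fun g => pairing f (MonoidAlgebra.single a c * MonoidAlgebra.single g 1 * (y + y'))) =
          (fun g => pairing f (MonoidAlgebra.single a c * MonoidAlgebra.single g 1 * y)) +
            fun g => pairing f (MonoidAlgebra.single a c * MonoidAlgebra.single g 1 * y') := by
        funext g; simp only [mul_add, Pi.add_apply, pairing_add]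
      rw [this]; exact J.add_mem hy hy'
    | single b c' =>
      have : (fun g => pairing f (MonoidAlgebra.single a c * MonoidAlgebra.single g 1 *
          MonoidAlgebra.single b c')) = (c * c') • fun g => f (a * g * b) := by
        funext g
        rw [MonoidAlgebra.single_mul_single, MonoidAlgebra.single_mul_single, Pi.smul_apply,
          smul_eq_mul, mul_one,
          show MonoidAlgebra.single (a * g * b) (c * c') = (c * c') • MonoidAlgebra.single (a * g * b) (1 : ℂ)
            by rw [MonoidAlgebra.smul_single', mul_one],
          pairing_smul, pairing_single]
      rw [this]; exact J.smul_mem _ (hJ f hf a b)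

/-! ## FIRST LEMMA — the kernel dichotomy by the matrix-unit sandwich -/

/-- **Kernel dichotomy.** If `J` is bi-invariant and some `f ∈ J` has a non-zero Fourier
coefficient in block `i = k.1`, then the block character `χᵢ` lies in `J`: with
`N := f̃(φ⁻¹E_{ab}) ≠ 0`, the functions `F_c(g) := f̃(φ⁻¹(E_{ac}) · g · φ⁻¹(E_{cb}))` are
generalized bi-translates of `f` (so lie in `J`), and `E_{ac} P E_{cb} = P_{cc} E_{ab}` gives
`Σ_c F_c = N · χᵢ`. -/
theorem character_mem_of_fourierCoeff_ne_zero [∀ i, NeZero (d i)]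
    (φ : MonoidAlgebra ℂ G ≃ₐ[ℂ] BlockAlgebraC d) (J : Submodule ℂ (G → ℂ))
    (hJ : ∀ f ∈ J, ∀ a b : G, (fun g : G => f (a * g * b)) ∈ J)
    {f : G → ℂ} (hf : f ∈ J) (k : BlockIndex d) (hk : fourierCoeff φ f k ≠ 0) :
    (blockRep φ k.1).character ∈ J := by
  obtain ⟨i, a, b⟩ := k
  set N : ℂ := fourierCoeff φ f ⟨i, (a, b)⟩ with hN
  let E : Fin (d i) → Fin (d i) → MonoidAlgebra ℂ G := fun u v => φ.symm (blockBasis ℂ d ⟨i, (u, v)⟩)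
  let F : Fin (d i) → G → ℂ := fun c g => pairing f (E a c * MonoidAlgebra.single g 1 * E c b)
  have hF : ∀ c, F c ∈ J := fun c => pairing_mul_single_mul_mem J hJ hf _ _
  have hkey : ∀ c g, F c g = φ (MonoidAlgebra.single g 1) i c c * N := by
    intro c g
    have h1 : E a c * MonoidAlgebra.single g 1 * E c b =
        (φ (MonoidAlgebra.single g 1) i c c) • E a b := by
      apply φ.injective
      simp only [E, map_mul, map_smul, AlgEquiv.apply_symm_apply, blockBasis_eq_single]
      rw [← Pi.single_mul_left, ← Pi.single_mul, Matrix.single_mul_mul_single, one_mul, mul_one,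
        ← Pi.single_smul, Matrix.smul_single, smul_eq_mul, mul_one]
    show pairing f (E a c * MonoidAlgebra.single g 1 * E c b) = _
    rw [h1, pairing_smul]
    rfl
  have hsum : (∑ c, F c) = N • (blockRep φ i).character := by
    funext g
    rw [Finset.sum_apply, Pi.smul_apply, smul_eq_mul, character_blockRep_apply, Matrix.trace]
    simp only [hkey, Matrix.diag_apply]
    rw [← Finset.sum_mul, mul_comm]
  have hmem : N • (blockRep φ i).character ∈ J := by
    rw [← hsum]; exact J.sum_mem fun c _ => hF c
  have h2 := J.smul_mem N⁻¹ hmem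
  rwa [smul_smul, inv_mul_cancel₀ hk, one_smul] at h2

/-- Contrapositive form used downstream: blocks whose character is not in `J` carry no Fourier
mass of any `f ∈ J`. -/
theorem fourierCoeff_eq_zero_of_character_not_mem [∀ i, NeZero (d i)]
    (φ : MonoidAlgebra ℂ G ≃ₐ[ℂ] BlockAlgebraC d) (J : Submodule ℂ (G → ℂ))
    (hJ : ∀ f ∈ J, ∀ a b : G, (fun g : G => f (a * g * b)) ∈ J)
    {f : G → ℂ} (hf : f ∈ J) (k : BlockIndex d) (hk : (blockRep φ k.1).character ∉ J) :
    fourierCoeff φ f k = 0 := by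
  by_contra h
  exact hk (character_mem_of_fourierCoeff_ne_zero φ J hJ hf k h)

/-! ## `J ⊆ RepFun(Λ_J)` and the bookkeeping -/

/-- **`J ⊆ RepFun(Λ_J)`**: every `f` in a bi-invariant `J` is a linear combination of matrix
coefficients of the blocks whose character lies in `J`. -/
theorem mem_repFun_visibleBlocks [∀ i, NeZero (d i)]
    (φ : MonoidAlgebra ℂ G ≃ₐ[ℂ] BlockAlgebraC d) (J : Submodule ℂ (G → ℂ))
    (hJ : ∀ f ∈ J, ∀ a b : G, (fun g : G => f (a * g * b)) ∈ J)
    {f : G → ℂ} (hf : f ∈ J) :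
    f ∈ repFun (fun i : {i : Fin r // (blockRep φ i).character ∈ J} => d i.1)
      (fun i => (blockHom φ i.1).toHomUnits) := by
  have hf' : f = ∑ k : BlockIndex d,
      fourierCoeff φ f k • (fun g => φ (MonoidAlgebra.single g 1) k.1 k.2.1 k.2.2) := by
    funext g
    rw [Finset.sum_apply]
    simp only [Pi.smul_apply, smul_eq_mul]
    exact eq_sum_fourierCoeff_mul φ f g
  rw [hf']
  refine Submodule.sum_mem _ fun k _ => ?_
  by_cases hk : (blockRep φ k.1).character ∈ J
  · refine Submodule.smul_mem _ _ (Submodule.subset_span ⟨⟨k.1, hk⟩, k.2.1, k.2.2, ?_⟩)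
    funext g
    simp only [MonoidHom.coe_toHomUnits, blockHom_apply]
  · rw [fourierCoeff_eq_zero_of_character_not_mem φ J hJ hf k hk, zero_smul]
    exact Submodule.zero_mem _

/-- **Bookkeeping**: the visible blocks have pairwise distinct irreducible characters lying in
`J`, so `Σ_{i ∈ Λ_J} dᵢ^s ≤ Σᶠ_{χ ∈ Irr(G) ∩ J} χ(1)^s`
(pattern of `sum_blockDegrees_rpow_le_charDegreePowSum`). -/
theorem sum_visibleBlocks_rpow_le [∀ i, NeZero (d i)]
    (φ : MonoidAlgebra ℂ G ≃ₐ[ℂ] BlockAlgebraC d) (J : Submodule ℂ (G → ℂ)) (s : ℝ) :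
    ∑ i : {i : Fin r // (blockRep φ i).character ∈ J}, (d i.1 : ℝ) ^ s ≤
      ∑ᶠ χ ∈ irrChars G ∩ (J : Set (G → ℂ)), (χ 1).re ^ s := by
  have hfin : (irrChars G ∩ (J : Set (G → ℂ))).Finite :=
    (irrChars_finite_holds G).subset Set.inter_subset_left
  rw [finsum_mem_eq_finite_toFinset_sum _ hfin]
  set χ : {i : Fin r // (blockRep φ i).character ∈ J} → (G → ℂ) :=
    fun i => (blockRep φ i.1).character with hχ
  have hinj : Function.Injective χ := fun i j h =>
    Subtype.ext (character_blockRep_injective φ h)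
  have hmem : ∀ i, χ i ∈ irrChars G ∩ (J : Set (G → ℂ)) := fun i =>
    ⟨⟨Fin (d i.1) → ℂ, inferInstance, inferInstance, inferInstance, blockRep φ i.1,
      isIrreducible_blockRep φ i.1, rfl⟩, i.2⟩
  have hdeg : ∀ i, ((χ i 1).re : ℝ) = d i.1 := fun i => by
    simp [hχ, Representation.char_one]
  have h1 : ∑ i : {i : Fin r // (blockRep φ i).character ∈ J}, (d i.1 : ℝ) ^ s =
      ∑ ψ ∈ Finset.univ.image χ, (ψ 1).re ^ s := by
    rw [Finset.sum_image fun i _ j _ h => hinj h]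
    exact Finset.sum_congr rfl fun i _ => by rw [hdeg]
  rw [h1]
  refine Finset.sum_le_sum_of_subset_of_nonneg ?_ fun ψ hψ _ => ?_
  · intro ψ hψ
    rw [Finset.mem_image] at hψ
    obtain ⟨i, _, rfl⟩ := hψ
    exact hfin.mem_toFinset.2 (hmem i)
  · obtain ⟨n, -, hn⟩ := IsIrrChar.exists_apply_one (hfin.mem_toFinset.1 hψ).1
    rw [hn]
    exact Real.rpow_nonneg (by simp) _

/-! ## Repackaging into the hypotheses of `BCGPU2024_thm_2_2_corrected_holds` -/

/-- **Repackaging**: a `J`-separated triple (route convention, words `x⁻¹ y y'⁻¹ z`) with `Y`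
non-empty yields, for `(X⁻¹, Y⁻¹, Z⁻¹)`, the embedding-form TPP and a BCGPU separating family
drawn from `J`. -/
theorem bcgpu_hypotheses_of_separated (J : Submodule ℂ (G → ℂ)) (X Y Z : Finset G)
    (hY : Y.Nonempty)
    (hsep : ∀ x₀ ∈ X, ∀ z₀ ∈ Z, ∃ f ∈ J, ∀ x ∈ X, ∀ y ∈ Y, ∀ y' ∈ Y, ∀ z ∈ Z,
      (x = x₀ ∧ y = y' ∧ z = z₀ → f (x⁻¹ * y * y'⁻¹ * z) = 1) ∧
      (¬ (x = x₀ ∧ y = y' ∧ z = z₀) → f (x⁻¹ * y * y'⁻¹ * z) = 0)) :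
    (∀ x ∈ X⁻¹, ∀ x' ∈ X⁻¹, ∀ y ∈ Y⁻¹, ∀ y' ∈ Y⁻¹, ∀ z ∈ Z⁻¹, ∀ z' ∈ Z⁻¹,
      x * y⁻¹ * y' * z⁻¹ = x' * z'⁻¹ → x = x' ∧ y = y' ∧ z = z') ∧
    ∃ f : G → G → (G → ℂ), IsSeparatingFamily X⁻¹ Y⁻¹ Z⁻¹ f ∧
      ∀ x ∈ X⁻¹, ∀ z ∈ Z⁻¹, f x z ∈ J := by
  obtain ⟨y₀, hy₀⟩ := hY
  have memX : ∀ {x : G}, x ∈ X⁻¹ → x⁻¹ ∈ X := fun h => Finset.mem_inv'.1 h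
  have memY : ∀ {y : G}, y ∈ Y⁻¹ → y⁻¹ ∈ Y := fun h => Finset.mem_inv'.1 h
  have memZ : ∀ {z : G}, z ∈ Z⁻¹ → z⁻¹ ∈ Z := fun h => Finset.mem_inv'.1 h
  constructor
  · -- embedding-form TPP for `(X⁻¹, Y⁻¹, Z⁻¹)` from separation
    intro x hx x' hx' y hy y' hy' z hz z' hz' he
    obtain ⟨f, -, hf⟩ := hsep x'⁻¹ (memX hx') z'⁻¹ (memZ hz')
    have h1 : f (x'⁻¹⁻¹ * y₀ * y₀⁻¹ * z'⁻¹) = 1 :=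
      (hf _ (memX hx') _ hy₀ _ hy₀ _ (memZ hz')).1 ⟨rfl, rfl, rfl⟩
    have e1 : x'⁻¹⁻¹ * y₀ * y₀⁻¹ * z'⁻¹ = x' * z'⁻¹ := by group
    by_contra hne
    have h0 : f (x⁻¹⁻¹ * y⁻¹ * y'⁻¹⁻¹ * z⁻¹) = 0 :=
      (hf _ (memX hx) _ (memY hy) _ (memY hy') _ (memZ hz)).2
        (fun ⟨h1', h2', h3'⟩ => hne ⟨inv_injective h1', inv_injective h2', inv_injective h3'⟩)
    have e0 : x⁻¹⁻¹ * y⁻¹ * y'⁻¹⁻¹ * z⁻¹ = x * y⁻¹ * y' * z⁻¹ := by simp only [inv_inv]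
    rw [e0, he, ← e1, h1] at h0
    exact one_ne_zero h0
  · -- the separating family, drawn from `J`
    choose! fsep hfsepJ hfsep using hsep
    refine ⟨fun x z => fsep x⁻¹ z⁻¹, ?_, ?_⟩
    · intro x hx z hz
      have hf := hfsep x⁻¹ (memX hx) z⁻¹ (memZ hz)
      refine ⟨?_, ?_⟩
      · have h1 := (hf _ (memX hx) _ hy₀ _ hy₀ _ (memZ hz)).1 ⟨rfl, rfl, rfl⟩
        have e1 : x⁻¹⁻¹ * y₀ * y₀⁻¹ * z⁻¹ = x * z⁻¹ := by group
        rwa [e1] at h1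
      · intro x' hx' y hy y' hy' z' hz' hne
        have h0 := (hf _ (memX hx') _ (memY hy) _ (memY hy') _ (memZ hz')).2 (by
          rintro ⟨h1', h2', h3'⟩
          apply hne
          have ex : x' = x := inv_injective h1'
          have ey : y = y' := inv_injective h2'
          have ez : z' = z := inv_injective h3'
          subst ex; subst ey; subst ez
          group)
        have e0 : x'⁻¹⁻¹ * y⁻¹ * y'⁻¹⁻¹ * z'⁻¹ = x' * y⁻¹ * y' * z'⁻¹ := by simp only [inv_inv]
        rwa [e0] at h0
    · intro x hx z hz
      exact hfsepJ x⁻¹ (memX hx) z⁻¹ (memZ hz)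

/-- The tree theorem the line composes with (PROVED there). -/
example : BCGPU2024_thm_2_2_corrected.{0} := BCGPU2024_thm_2_2_corrected_holds

/-! ## Shape check of the composition (validates that the five pieces have the right types;
a candidate for the lead prover to land under `Theorems/`, NOT proposed by this planner seat) -/

/-- **Composition check**: kernel + inversion + bookkeeping + repackaging +
`BCGPU2024_thm_2_2_corrected_holds` give the crux `GradedPricing` by name. -/
theorem gradedPricing_candidate :
    Summit.MatrixMultiplication.MatrixMultiplication.Theses.LevelGradedCohnUmans.GradedPricing := by
  intro G _ _ J hJ X Y Z hsep
  have hω0 : 0 < omega ℂ := zero_lt_two.trans_le (omega_two_le (K := ℂ))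
  have hfin : (irrChars G ∩ (J : Set (G → ℂ))).Finite :=
    (irrChars_finite_holds G).subset Set.inter_subset_left
  rcases Nat.eq_zero_or_pos (X.card * Y.card * Z.card) with hq | hq
  · -- zero volume: `0 ≤ Σᶠ`
    rw [hq, Nat.cast_zero, Real.zero_rpow (div_pos hω0 three_pos).ne',
      finsum_mem_eq_finite_toFinset_sum _ hfin]
    exact Finset.sum_nonneg fun ψ hψ => by
      obtain ⟨n, -, hn⟩ := IsIrrChar.exists_apply_one (hfin.mem_toFinset.1 hψ).1
      rw [hn]
      exact Real.rpow_nonneg (by simp) _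
  · have hY : Y.Nonempty := Finset.card_pos.1 (Nat.pos_of_ne_zero fun h => by simp [h] at hq)
    obtain ⟨r, d, hd, ⟨φ⟩⟩ := exists_algEquiv_pi_matrix G
    haveI := hd
    obtain ⟨hTPP, fsep, hfsep, hmemJ⟩ := bcgpu_hypotheses_of_separated J X Y Z hY hsep
    have hmem : ∀ x ∈ X⁻¹, ∀ z ∈ Z⁻¹, fsep x z ∈
        repFun (fun i : {i : Fin r // (blockRep φ i).character ∈ J} => d i.1)
          (fun i => (blockHom φ i.1).toHomUnits) :=
      fun x hx z hz => mem_repFun_visibleBlocks φ J hJ (hmemJ x hx z hz)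
    have key := BCGPU2024_thm_2_2_corrected_holds G X⁻¹ Y⁻¹ Z⁻¹ hTPP
      {i : Fin r // (blockRep φ i).character ∈ J} (fun i => d i.1)
      (fun i => (blockHom φ i.1).toHomUnits) fsep hfsep hmem
    rw [Finset.card_inv, Finset.card_inv, Finset.card_inv] at key
    exact key.trans (sum_visibleBlocks_rpow_le φ J (omega ℂ))

end Summit.MatrixMultiplication.MatrixMultiplication.Cruxes.GradedPricing.MatrixUnitSandwich

end
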